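import Summits.BirchSwinnertonDyer.Rank1Residual.X2.ResidualDevissageNoTorsion
import Summits.BirchSwinnertonDyer.Rank1Residual.X2.GreenbergSelmerCountSplit
import HarnessLib

/-!
# Greenberg–Vatsal 2000, §2 display (16) AT A MULTIPLICATIVE EISENSTEIN PRIME — the `E`-side of
# `λ^alg_{E,Σ₀} = λ_{φ,Σ₀} + λ_{ψ,Σ₀}` as a kernel identity:
# `#H¹(ℚ_Σ/ℚ_∞, Φ₀) · #S^{Σ₀}_{E[p]/Φ₀}(ℚ_∞) = p^{λ_E + Σδ + e_p}`

HONEST FRAMING (cell `b2b-bsdres`, run/shared/lean/b2b/bsd-rank1-residual/, verbatim in every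
file): the goal of the cell is to DELETE the COMBINATION-SHAPED residual classes of the
Birch–Swinnerton-Dyer formula for ALL analytic-rank `≤ 1` elliptic curves over `ℚ` — "full BSD
formula for every rank `≤ 1` curve in class `C`" assembled STRICTLY from published theorems — so
that the rank-`≤ 1` remainder becomes exactly the CONSTRUCTION-SHAPED classes, which are TYPED
(missing-input `Prop`s), NOT attempted. This is not "finishing BSD". Sub-cell
`b2b-bsdres-eisenstein-p2` (CLASS-OWNERS row "X2"), gen 16: research route; NO CLAIM BEYOND STATED
CLASSES; nothing here changes a label; no NEW named fact (the published inputs below are the cell's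
registered facts A40/A41, A133, A135, A137); theorems only.

WHAT. Sub-cell X2a is closed in the kernel modulo the named fact
`GreenbergVatsal2000.lambda_muAnal_multiplicative_of_gvPar` (flag `GV00-mult-asserted`: GV's
Thm. (1.3) is printed for good ordinary `p`; the `E`-dependent step of its proof is display (16),
whose paragraph opens "Assume also that `E` has good ordinary reduction at `p`"). Display (16) at
`p ‖ N` reads, on the algebraic side (GV pp. 25, 28–30, with the trivial zero of pp. 14–15 and the
`E(ℚ)[p]`-correction of Prop. (2.8)):
`dim S^{Σ₀}_{E[p]}(ℚ_∞) = λ_E + Σ_{ℓ∈Σ₀} δ_ℓ + e_p = λ_{φ,Σ₀} + λ_{ψ,Σ₀}`,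
`λ_{φ,Σ₀} = dim H¹(ℚ_Σ/ℚ_∞, Φ)`, `λ_{ψ,Σ₀} = dim S^{Σ₀}_Ψ(ℚ_∞)` (the correction `t = dim E(ℚ_∞)[p]`
VANISHES in GV's first case: `X2/ResidualDevissageNoTorsion.lean`). THIS FILE PROVES EXACTLY THAT
IDENTITY as a kernel theorem for `E/ℚ` globally minimal, `p` odd with
`p ‖ N` (split or non-split), `Φ₀ ≤ E[p]` a rational line RAMIFIED at `p` and EVEN (the first case
of `GVPar`), `κ` the cyclotomic `ℤ_p`-extension, `Σ₀ ∌ p` finite containing the bad primes `≠ p`,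
from: the cell's GV §2 Literature facts A133 (`lambda_nonPrimitive_eq_add_sum_delta_multiplicative`,
GV (5)–(7) at `p ‖ N`), A135 (`datumSelmer_divisible_of_finite_torsionBy`, GV Prop. (2.5) / p. 25),
A137 (`datumStrictSelmer_lt_datumSelmer_of_split`, GV p. 15 — split case only), the Tate
uniformisation A40/A41 (Silverman 1994 V.5.3/5.4), and ONE hypothesis: the lifting property
`S^{Σ₀}_{E[p]/Φ₀}(ℚ_∞) ⊆ q_* H¹(ℚ_Σ/ℚ_∞, E[p])` (GV pp. 29–30 "`H²(ℚ_Σ/ℚ_∞, Φ) = 0`",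
Ferrero–Washington + Iwasawa + Greenberg 1999 Prop. 4 — character-theoretic). Everything about
`E` in (16) at `p ‖ N` is thereby a tree theorem: Tate datum (gens 9, 12, 13), `Φ₀ = C[p]`
(`ResidualDevissageLine.torsionData_plus_eq_lineSub`), `ψ` odd ⇒ `(E[p]/Φ₀)^{Gal(ℚ̄/ℚ_∞)} = 0`
(`ResidualDevissageLine.forall_fixed_quot_eq_zero`), the devissage
(`ResidualDevissageSelmer.natCard_datumSelmer_eq_mul`), the `E(ℚ_∞)[p]`-corrected Prop. (2.8)
(`GreenbergVatsalTorsionCurve.natCard_gvSelmer_torsion_curve`, its correction term killed by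
`ResidualDevissageNoTorsion.natCard_fixedPoints_quot_eq_one_of_line`) and the counts of gen 13. What remains
PRINTED for the X2a chain: the character counts `#H¹(ℚ_Σ/ℚ_∞, Φ₀) = p^{λ_{φ,Σ₀}}`,
`#S^{Σ₀}_Ψ = p^{λ_{ψ,Σ₀}}` (Iwasawa, Mazur–Wiles, Ferrero–Washington), `H² = 0`, and the ANALYTIC
side (GV Thm. (3.11) — its proof prints the `p ∣ M` paragraph —, (26)–(28), §3 periods).

CONTENT (theorems only). §1 `exists_data_count_of_not_split` / `exists_data_count_of_split`: gen 13's counts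
(`GreenbergSelmerCount{Nonsplit,Split}`) RE-DERIVED verbatim with the residual-line cardinality
`#(C ∩ E[p^∞][p]) = p` of the Tate data kept in the conclusion (needed by the devissage).
§2 **`natCard_line_mul_quotSelmer_eq_of_not_split`**, **`…_of_split`**: the identity above.

References: Greenberg–Vatsal, Invent. Math. 142 (2000) = arXiv:math/9906215, §1 (5)–(7), §2 pp.
14–16, 25, 28–30, Props. (2.5), (2.8); Silverman, *Advanced Topics* V.5.3–5.4.
-/

noncomputable section

open scoped Classical AddSubgroup

namespace Summit.BirchSwinnertonDyer.Rank1Residual.X2.ResidualDevissageMultiplicative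

open NumberField IsDedekindDomain Field Literature.NumberTheory.GaloisRepresentations
  Literature.NumberTheory.EllipticCurves Literature.NumberTheory.EllipticCurves.GreenbergSelmer
  Literature.NumberTheory.EllipticCurves.GreenbergVatsal2000 IsDedekindDomain.HeightOneSpectrum
  Literature.NumberTheory.EllipticCurves.Rank1Residual
  Summit.BirchSwinnertonDyer.Rank1Residual.X2.GreenbergVatsalTorsion
  Summit.BirchSwinnertonDyer.Rank1Residual.X2.GreenbergVatsalStrictSelmer
  Summit.BirchSwinnertonDyer.Rank1Residual.X2.GreenbergVatsalTateDatum
  Summit.BirchSwinnertonDyer.Rank1Residual.X2.GreenbergVatsalTateDatumSign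
  Summit.BirchSwinnertonDyer.Rank1Residual.X2.GreenbergVatsalTateDatumTorsion
  Summit.BirchSwinnertonDyer.Rank1Residual.X2.NonPrimitiveSelmerStrictEquality
  Summit.BirchSwinnertonDyer.Rank1Residual.X2.GreenbergVatsalStrictSelmerMultiplicative
  Summit.BirchSwinnertonDyer.Rank1Residual.X2.GreenbergVatsalTateDatumCofree
  Summit.BirchSwinnertonDyer.Rank1Residual.X2.NonPrimitiveSelmerCorank
  Summit.BirchSwinnertonDyer.Rank1Residual.X2.NonPrimitiveSelmerTorsionCard
  Summit.BirchSwinnertonDyer.Rank1Residual.X2.GreenbergSelmerCountNonsplit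
  Summit.BirchSwinnertonDyer.Rank1Residual.X2.GreenbergSelmerCountSplit
  Summit.BirchSwinnertonDyer.Rank1Residual.X2.TrivialZeroQuotient
  Summit.BirchSwinnertonDyer.Rank1Residual.X2.TrivialZeroCorankAlgebra
  Summit.BirchSwinnertonDyer.Rank1Residual.X2.ResidualDevissageModules
  Summit.BirchSwinnertonDyer.Rank1Residual.X2.ResidualDevissageSelmer
  Summit.BirchSwinnertonDyer.Rank1Residual.X2.ResidualDevissageLine
  Summit.BirchSwinnertonDyer.Rank1Residual.X2.ResidualDevissageNoTorsion

variable (W : WeierstrassCurve ℚ) [W.IsGloballyMinimal] [W.IsElliptic] (p : ℕ) [hp : Fact p.Prime]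
  (κ : ZpExtension ℚ p) {γ : absoluteGaloisGroup ℚ} (S₀ : Finset (HeightOneSpectrum (𝓞 ℚ)))

/-! ## §1. Gen 13's counts with the residual-line cardinality exported -/

/-- **NON-SPLIT odd `p ‖ N`**: Tate data `L` with `htriv`, `hgen`, `#(C ∩ E[p^∞][p]) = p`,
`Sel^{Σ₀} = S^{Σ₀}` and `#(S^{Σ₀}_{E[p^∞]}(ℚ_∞) ⊓ H¹[p]) = p^{λ(E) + Σδ}` — verbatim
`GreenbergSelmerCountNonsplit.exists_data_natCard_gvSelmerInfty_inf_torsion_eq_pow_of_not_split`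
with the line cardinality of `GreenbergVatsalTateDatumCofree.exists_data_of_not_split` kept.
[cite: GreenbergVatsal2000, §1 (5)–(7) pp. 7–8; §2 pp. 14–16, Prop. (2.5), p. 25] -/
theorem exists_data_count_of_not_split
    (hT : Silverman1994_thmV53_corV54_tateUniformisation.{0})
    (hA : lambda_nonPrimitive_eq_add_sum_delta_multiplicative)
    (hB : datumSelmer_divisible_of_finite_torsionBy)
    (hκ : κ.IsCyclotomic) (hγ : κ.IsTopGenerator γ) (hp2 : p ≠ 2)
    (hmult : W.HasMultiplicativeReductionAtPrime p) (hns : ¬ W.HasSplitMultiplicativeReductionAtPrime p)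
    (hS₀ : ∀ v ∈ S₀, ((p : ℕ) : 𝓞 ℚ) ∉ v.asIdeal)
    (hS : ∀ v : HeightOneSpectrum (𝓞 ℚ), v ∉ S₀ → ((p : ℕ) : 𝓞 ℚ) ∉ v.asIdeal →
      W.HasGoodReductionAt v)
    (D : W.SelmerDualData κ γ) [Module.Finite (IwasawaAlgebra p) D.X] (hX : D.IsTorsion)
    (hμ : D.mu = 0) :
    ∃ L : Data ℚ (W.geomPrimaryTorsion p) p,
      (∀ (v : HeightOneSpectrum (𝓞 ℚ)) (hv : ((p : ℕ) : 𝓞 ℚ) ∈ v.asIdeal),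
        ∀ x ∈ inertia v, ∀ m : W.geomPrimaryTorsion p, x • m - m ∈ (L v hv).plus) ∧
      (∀ (v : HeightOneSpectrum (𝓞 ℚ)) (hv : ((p : ℕ) : 𝓞 ℚ) ∈ v.asIdeal),
        ∀ c ∈ (torsionData L p v hv).plus, ∃ τ ∈ inertia v,
          ∃ c' ∈ (torsionData L p v hv).plus, τ • c' - c' = c) ∧
      (∀ (v : HeightOneSpectrum (𝓞 ℚ)) (hv : ((p : ℕ) : 𝓞 ℚ) ∈ v.asIdeal),
        Nat.card ↥((L v hv).plus ⊓ (↥(W.geomPrimaryTorsion p))[(p : ℤ)]) = p) ∧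
      nonPrimitiveSelmerInfty W κ (↑S₀ : Set (HeightOneSpectrum (𝓞 ℚ))) =
        gvSelmerInfty κ (W.geomPrimaryTorsion p) L (↑S₀ : Set (HeightOneSpectrum (𝓞 ℚ))) ∧
      Nat.card ↥(gvSelmerInfty κ (W.geomPrimaryTorsion p) L (↑S₀ : Set (HeightOneSpectrum (𝓞 ℚ))) ⊓
          (subgroupH1 κ.kerSubgroup (W.geomPrimaryTorsion p))[(p : ℤ)]) =
        p ^ (lambdaInvariant p D.X + ∑ v ∈ S₀, delta W p v) := by
  obtain ⟨L, htriv, hgen, hC, heqK, hle, hge⟩ :=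
    exists_data_of_not_split W p κ hT hκ hp2 hmult hns
  set S₀' : Set (HeightOneSpectrum (𝓞 ℚ)) := ↑S₀ with hS₀'
  have hS₀'' : ∀ v ∈ S₀', ((p : ℕ) : 𝓞 ℚ) ∉ v.asIdeal := fun v hv ↦ hS₀ v (Finset.mem_coe.1 hv)
  have hS' : ∀ v : HeightOneSpectrum (𝓞 ℚ), v ∉ S₀' → ((p : ℕ) : 𝓞 ℚ) ∉ v.asIdeal →
      W.HasGoodReductionAt v := fun v hv hpv ↦ hS v (fun h ↦ hv (Finset.mem_coe.2 h)) hpv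
  -- `Sel^{Σ₀} = S^{Σ₀,str} = S^{Σ₀}`
  have heq₁ : nonPrimitiveSelmerInfty W κ S₀' =
      gvStrictSelmerInfty κ (W.geomPrimaryTorsion p) L S₀' :=
    nonPrimitiveSelmerInfty_eq_gvStrictSelmerInfty_of_le W p κ L S₀' hp2 hκ hS₀'' hS' hle hge
  have heq₂ : gvStrictSelmerInfty κ (W.geomPrimaryTorsion p) L S₀' =
      gvSelmerInfty κ (W.geomPrimaryTorsion p) L S₀' :=
    gvStrictSelmerInfty_eq_gvSelmerInfty_of_forall_eq κ (W.geomPrimaryTorsion p) L S₀' heqK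
  have heq : nonPrimitiveSelmerInfty W κ S₀' = gvSelmerInfty κ (W.geomPrimaryTorsion p) L S₀' :=
    heq₁.trans heq₂
  -- corank and finiteness of `Sel^{Σ₀}[p]` (GV (7) at `p ‖ N`)
  obtain ⟨hfin, hcork⟩ :=
    finite_torsionBy_and_zpCorank_nonPrimitiveSelmerInfty_eq_multiplicative W S₀ hA hp2 hmult hκ hγ
      hS₀ D hX hμ
  haveI := hfin
  -- finiteness of `S^{Σ₀} ⊓ H¹[p]`
  haveI hfinS : Finite ↥(gvSelmerInfty κ (W.geomPrimaryTorsion p) L S₀' ⊓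
      (subgroupH1 κ.kerSubgroup (W.geomPrimaryTorsion p))[(p : ℤ)]) := by
    rw [← heq, finite_inf_torsionBy_iff]; exact hfin
  -- divisibility of `S^{Σ₀}` (GV Prop. (2.5) / p. 25)
  have hdiv : ∀ s : nonPrimitiveSelmerInfty W κ S₀', ∃ t : nonPrimitiveSelmerInfty W κ S₀',
      p • t = s := by
    intro s
    have hs : (s : W.subgroupH1 p κ.kerSubgroup) ∈
        datumSelmerInfty κ (W.geomPrimaryTorsion p) L S₀' := by
      rw [← gvSelmerInfty_eq_datumSelmerInfty, ← heq]; exact s.2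
    obtain ⟨t, ht, hts⟩ := hB W p hp2 κ hκ L hC htriv S₀ hS₀ hS hfinS (s : W.subgroupH1 p κ.kerSubgroup)
      hs
    have ht' : t ∈ nonPrimitiveSelmerInfty W κ S₀' := by
      rw [heq]; exact ht
    exact ⟨⟨t, ht'⟩, Subtype.ext (by rw [AddSubgroupClass.coe_nsmul]; exact hts)⟩
  refine ⟨L, htriv, hgen, fun v hv ↦ (hC v hv).2, heq, ?_⟩
  rw [← heq, natCard_inf_torsionBy_eq, ← hcork]
  exact natCard_torsionBy_eq_pow_zpCorank_of_divisible p (isPrimary_nonPrimitiveSelmerInfty W S₀) hdiv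

/-- **SPLIT odd `p ‖ N`**: Tate data `L` with `htriv`, `hgen`, `#(C ∩ E[p^∞][p]) = p`,
`Sel^{Σ₀} = S^{Σ₀,str}` and `#(S^{Σ₀}_{E[p^∞]}(ℚ_∞) ⊓ H¹[p]) = p^{λ(E) + Σδ + 1}` — verbatim
`GreenbergSelmerCountSplit.exists_data_natCard_gvSelmerInfty_inf_torsion_eq_pow_of_split` with the
line cardinality of `GreenbergVatsalTateDatumCofree.exists_data_of_split` kept.
[cite: GreenbergVatsal2000, §1 (5)–(7) pp. 7–8, pp. 14–15; §2 Prop. (2.1), (2.5), pp. 20, 25] -/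
theorem exists_data_count_of_split
    (hT : Silverman1994_thmV53_tateUniformisation.{0})
    (hA : lambda_nonPrimitive_eq_add_sum_delta_multiplicative)
    (hB : datumSelmer_divisible_of_finite_torsionBy)
    (hF : datumStrictSelmer_lt_datumSelmer_of_split)
    (hκ : κ.IsCyclotomic) (hγ : κ.IsTopGenerator γ) (hp2 : p ≠ 2)
    (hsplit : W.HasSplitMultiplicativeReductionAtPrime p)
    (hS₀ : ∀ v ∈ S₀, ((p : ℕ) : 𝓞 ℚ) ∉ v.asIdeal)
    (hS : ∀ v : HeightOneSpectrum (𝓞 ℚ), v ∉ S₀ → ((p : ℕ) : 𝓞 ℚ) ∉ v.asIdeal →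
      W.HasGoodReductionAt v)
    (D : W.SelmerDualData κ γ) [Module.Finite (IwasawaAlgebra p) D.X] (hX : D.IsTorsion)
    (hμ : D.mu = 0) :
    ∃ L : Data ℚ (W.geomPrimaryTorsion p) p,
      (∀ (v : HeightOneSpectrum (𝓞 ℚ)) (hv : ((p : ℕ) : 𝓞 ℚ) ∈ v.asIdeal),
        ∀ x ∈ inertia v, ∀ m : W.geomPrimaryTorsion p, x • m - m ∈ (L v hv).plus) ∧
      (∀ (v : HeightOneSpectrum (𝓞 ℚ)) (hv : ((p : ℕ) : 𝓞 ℚ) ∈ v.asIdeal),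
        ∀ c ∈ (torsionData L p v hv).plus, ∃ τ ∈ inertia v,
          ∃ c' ∈ (torsionData L p v hv).plus, τ • c' - c' = c) ∧
      (∀ (v : HeightOneSpectrum (𝓞 ℚ)) (hv : ((p : ℕ) : 𝓞 ℚ) ∈ v.asIdeal),
        Nat.card ↥((L v hv).plus ⊓ (↥(W.geomPrimaryTorsion p))[(p : ℤ)]) = p) ∧
      nonPrimitiveSelmerInfty W κ (↑S₀ : Set (HeightOneSpectrum (𝓞 ℚ))) =
        gvStrictSelmerInfty κ (W.geomPrimaryTorsion p) L (↑S₀ : Set (HeightOneSpectrum (𝓞 ℚ))) ∧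
      Nat.card ↥(gvSelmerInfty κ (W.geomPrimaryTorsion p) L (↑S₀ : Set (HeightOneSpectrum (𝓞 ℚ))) ⊓
          (subgroupH1 κ.kerSubgroup (W.geomPrimaryTorsion p))[(p : ℤ)]) =
        p ^ (lambdaInvariant p D.X + ∑ v ∈ S₀, delta W p v + 1) := by
  have hmult : W.HasMultiplicativeReductionAtPrime p := hsplit.hasMultiplicativeReductionAtPrime
  obtain ⟨L, htriv, hgen, hC, htrivD, hle, hge⟩ := exists_data_of_split W p κ hT hp2 hsplit
  -- the place above `p`
  set v₀ : HeightOneSpectrum (𝓞 ℚ) := (Rat.HeightOneSpectrum.primesEquiv (R := 𝓞 ℚ)).symm ⟨p, hp.out⟩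
    with hv₀def
  have hv₀ : ((p : ℕ) : 𝓞 ℚ) ∈ v₀.asIdeal :=
    (natCast_mem_asIdeal_iff_eq_primesEquiv_symm v₀ hp.out).mpr hv₀def
  have hS₀'' : ∀ v ∈ (↑S₀ : Set (HeightOneSpectrum (𝓞 ℚ))), ((p : ℕ) : 𝓞 ℚ) ∉ v.asIdeal :=
    fun v hv ↦ hS₀ v (Finset.mem_coe.1 hv)
  have hS' : ∀ v : HeightOneSpectrum (𝓞 ℚ), v ∉ (↑S₀ : Set (HeightOneSpectrum (𝓞 ℚ))) →
      ((p : ℕ) : 𝓞 ℚ) ∉ v.asIdeal → W.HasGoodReductionAt v :=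
    fun v hv hpv ↦ hS v (fun h ↦ hv (Finset.mem_coe.2 h)) hpv
  -- `T := Sel^{Σ₀} = S^{Σ₀,str} ≤ S := S^{Σ₀}`
  have heqT : nonPrimitiveSelmerInfty W κ (↑S₀ : Set (HeightOneSpectrum (𝓞 ℚ))) =
      gvStrictSelmerInfty κ (W.geomPrimaryTorsion p) L ↑S₀ :=
    nonPrimitiveSelmerInfty_eq_gvStrictSelmerInfty_of_le W p κ L _ hp2 hκ hS₀'' hS' hle hge
  have hTS : nonPrimitiveSelmerInfty W κ (↑S₀ : Set (HeightOneSpectrum (𝓞 ℚ))) ≤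
      gvSelmerInfty κ (W.geomPrimaryTorsion p) L ↑S₀ :=
    heqT.le.trans (gvStrictSelmerInfty_le_gvSelmerInfty κ _ L _)
  -- (a) corank and finiteness of `T[p]`
  obtain ⟨hfinT, hcorkT⟩ :=
    finite_torsionBy_and_zpCorank_nonPrimitiveSelmerInfty_eq_multiplicative W S₀ hA hp2 hmult hκ hγ
      hS₀ D hX hμ
  haveI := hfinT
  -- (b) the trivial-zero map `Φ : S → D` with kernel `T`
  obtain ⟨Φ, hΦ⟩ := exists_trivialZeroHom W p κ L htrivD (↑S₀ : Set (HeightOneSpectrum (𝓞 ℚ))) hκ hv₀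
  have hΦT : ∀ c : ↥(gvSelmerInfty κ (W.geomPrimaryTorsion p) L ↑S₀),
      Φ c = 0 ↔ (c : W.subgroupH1 p κ.kerSubgroup) ∈
        nonPrimitiveSelmerInfty W κ (↑S₀ : Set (HeightOneSpectrum (𝓞 ℚ))) := fun c ↦ by
    rw [hΦ c, heqT]
  -- (c) `D[p]` finite of order `p`
  obtain ⟨hfinGr, hcardGr⟩ :=
    finite_and_natCard_torsionBy_gr W p (L v₀ hv₀) (hC v₀ hv₀).1 (hC v₀ hv₀).2
  haveI := hfinGr
  -- (d) `S[p]` finite (kernel `↪ T[p]`, target `D[p]`)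
  haveI hfinS : Finite ((↥(gvSelmerInfty κ (W.geomPrimaryTorsion p) L ↑S₀))[(p : ℤ)]) :=
    finite_torsionBy_of_hom Φ hΦT
  have hfinS' : Finite ↥(gvSelmerInfty κ (W.geomPrimaryTorsion p) L ↑S₀ ⊓
      (subgroupH1 κ.kerSubgroup (W.geomPrimaryTorsion p))[(p : ℤ)]) :=
    (finite_inf_torsionBy_iff _ _).2 hfinS
  -- (e) `S` divisible (GV Prop. (2.5) / p. 25)
  have hdiv : ∀ s : ↥(gvSelmerInfty κ (W.geomPrimaryTorsion p) L ↑S₀),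
      ∃ t : ↥(gvSelmerInfty κ (W.geomPrimaryTorsion p) L ↑S₀), p • t = s := by
    intro s
    obtain ⟨t, ht, hts⟩ := hB W p hp2 κ hκ L hC htriv S₀ hS₀ hS hfinS'
      (s : W.subgroupH1 p κ.kerSubgroup) s.2
    exact ⟨⟨t, ht⟩, Subtype.ext (by rw [AddSubgroupClass.coe_nsmul]; exact hts)⟩
  -- (f) `Φ ≠ 0` (GV p. 15)
  haveI := hfinS'
  have hfinA : Finite ↥(gvSelmerInfty κ (W.geomPrimaryTorsion p) L ∅ ⊓
      (subgroupH1 κ.kerSubgroup (W.geomPrimaryTorsion p))[(p : ℤ)]) :=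
    finite_inf_torsionBy_of_le (p : ℤ)
      (gvSelmerInfty_empty_le W p κ L (↑S₀ : Set (HeightOneSpectrum (𝓞 ℚ))))
  have hfix := finite_fixedPoints_kerSubgroup_of_split W p κ hT hp2 hsplit hκ
  obtain ⟨c₀, hc₀⟩ := exists_apply_ne_zero_of_split W p κ L (↑S₀ : Set (HeightOneSpectrum (𝓞 ℚ)))
    hF hκ hp2 hsplit hC htriv hfinA hfix Φ hΦ
  -- (g) `corank S = corank T + corank R`, `R = Φ(S)`
  have hprimS : ∀ s : ↥(gvSelmerInfty κ (W.geomPrimaryTorsion p) L ↑S₀), ∃ n : ℕ, p ^ n • s = 0 :=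
    fun s ↦ by
    obtain ⟨n, hn⟩ := W.exists_pow_smul_subgroupH1_ker_eq_zero κ (s : W.subgroupH1 p κ.kerSubgroup)
    exact ⟨n, Subtype.ext (by rw [AddSubgroupClass.coe_nsmul]; exact hn)⟩
  have hadd := zpCorank_eq_add_of_hom p hTS Φ hΦT hprimS
  -- (h) `corank R = 1`
  have hprimR : ∀ r : ↥Φ.range, ∃ n : ℕ, p ^ n • r = 0 := fun r ↦ by
    obtain ⟨n, hn⟩ := primary_gr W p (L v₀ hv₀) (r : (L v₀ hv₀).Gr)
    exact ⟨n, Subtype.ext (by rw [AddSubgroupClass.coe_nsmul]; exact hn)⟩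
  obtain ⟨hfinR, hdvd⟩ := finite_and_natCard_torsionBy_dvd_of_le (p : ℤ) Φ.range
  haveI := hfinR
  rw [hcardGr] at hdvd
  have hne : (⟨Φ c₀, ⟨c₀, rfl⟩⟩ : ↥Φ.range) ≠ 0 := fun h ↦ hc₀ (congrArg Subtype.val h)
  have hR : zpCorank (↥Φ.range) p = 1 :=
    zpCorank_eq_one p hprimR (range_divisible p Φ hdiv) hne hdvd
  -- (i) assemble
  refine ⟨L, htriv, hgen, fun v hv ↦ (hC v hv).2, heqT, ?_⟩
  rw [natCard_inf_torsionBy_eq, natCard_torsionBy_eq_pow_zpCorank_of_divisible p hprimS hdiv, hadd, hR,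
    hcorkT]

/-! ## §2. Display (16) at `p ‖ N`: the `E`-side identity -/

variable {Φ₀ : AddSubgroup (W.geomTorsion (p : ℤ))} (hΦ : IsRationalLine W p Φ₀)

/-- **GV (16) at a NON-SPLIT odd `p ‖ N`, `E`-side:**
`#H¹(ℚ_Σ/ℚ_∞, Φ₀) · #S^{Σ₀}_{E[p]/Φ₀}(ℚ_∞) = p^{λ(E) + Σ_{v∈Σ₀} δ_v}`
for a rational line `Φ₀` ramified at `p` and even, `μ(E) = 0`, granted A41, A133, A135 and the
lifting property. [cite: GreenbergVatsal2000, §2 pp. 25, 28–30 (display (16))] -/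
theorem natCard_line_mul_quotSelmer_eq_of_not_split
    (hT : Silverman1994_thmV53_corV54_tateUniformisation.{0})
    (hA : lambda_nonPrimitive_eq_add_sum_delta_multiplicative)
    (hB : datumSelmer_divisible_of_finite_torsionBy)
    (hκ : κ.IsCyclotomic) (hγ : κ.IsTopGenerator γ) (hp2 : p ≠ 2)
    (hmult : W.HasMultiplicativeReductionAtPrime p) (hns : ¬ W.HasSplitMultiplicativeReductionAtPrime p)
    (hS₀ : ∀ v ∈ S₀, ((p : ℕ) : 𝓞 ℚ) ∉ v.asIdeal)
    (hS : ∀ v : HeightOneSpectrum (𝓞 ℚ), v ∉ S₀ → ((p : ℕ) : 𝓞 ℚ) ∉ v.asIdeal →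
      W.HasGoodReductionAt v)
    (D : W.SelmerDualData κ γ) [Module.Finite (IwasawaAlgebra p) D.X] (hX : D.IsTorsion)
    (hμ : D.mu = 0) (hram : ¬ LineUnramifiedAt W p Φ₀) (heven : LineEven W p Φ₀)
    (hlift : ∀ s ∈ ResidualDevissageSelmer.quotSelmer κ.kerSubgroup
        (ResidualDevissageLine.lineSub Φ₀ hΦ).Quot p (↑S₀ : Set (HeightOneSpectrum (𝓞 ℚ))),
      ∃ x ∈ GreenbergVatsal2000.unramifiedOutside κ.kerSubgroup
          ↥((↥(W.geomPrimaryTorsion p))[(p : ℤ)]) p (↑S₀ : Set (HeightOneSpectrum (𝓞 ℚ))),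
        ResidualDevissageSelmer.subH1 κ.kerSubgroup (ResidualDevissageLine.lineSub Φ₀ hΦ).proj
          (ResidualDevissageLine.lineSub Φ₀ hΦ).proj_smul x = s) :
    Nat.card (GreenbergVatsal2000.unramifiedOutside κ.kerSubgroup
        (ResidualDevissageLine.lineSub Φ₀ hΦ).Sub p (↑S₀ : Set (HeightOneSpectrum (𝓞 ℚ)))) *
      Nat.card (ResidualDevissageSelmer.quotSelmer κ.kerSubgroup
        (ResidualDevissageLine.lineSub Φ₀ hΦ).Quot p (↑S₀ : Set (HeightOneSpectrum (𝓞 ℚ)))) =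
    p ^ (lambdaInvariant p D.X + ∑ v ∈ S₀, delta W p v) := by
  obtain ⟨L, htriv, -, hcard, -, hcount⟩ :=
    exists_data_count_of_not_split W p κ S₀ hT hA hB hκ hγ hp2 hmult hns hS₀ hS D hX hμ
  have hS' : ∀ v : HeightOneSpectrum (𝓞 ℚ), v ∉ (↑S₀ : Set (HeightOneSpectrum (𝓞 ℚ))) →
      ((p : ℕ) : 𝓞 ℚ) ∉ v.asIdeal → W.HasGoodReductionAt v :=
    fun v hv hpv ↦ hS v (fun h ↦ hv (Finset.mem_coe.2 h)) hpv
  obtain ⟨c, hc⟩ := exists_isComplexConjugation (Rat.castHom ℝ)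
  have hdev := ResidualDevissageLine.natCard_gvSelmer_torsion_eq_mul_of_line hΦ hp2 hram heven L
    htriv hcard (↑S₀ : Set (HeightOneSpectrum (𝓞 ℚ))) hS' κ.kerSubgroup
    (ResidualDevissageLine.mem_kerSubgroup_of_isComplexConjugation κ hc) hc hlift
  have h28 := GreenbergVatsalTorsionCurve.natCard_gvSelmer_torsion_curve W p κ.kerSubgroup L
    (↑S₀ : Set (HeightOneSpectrum (𝓞 ℚ))) hS' htriv
  rw [← hdev, h28, natCard_fixedPoints_quot_eq_one_of_line W p κ hΦ hT hp2 hmult hκ hram heven,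
    mul_one]
  change Nat.card ↥(gvSelmerInfty κ (W.geomPrimaryTorsion p) L ↑S₀ ⊓ _) = _
  rw [hcount]

/-- **GV (16) at a SPLIT odd `p ‖ N`, `E`-side (trivial zero included):**
`#H¹(ℚ_Σ/ℚ_∞, Φ₀) · #S^{Σ₀}_{E[p]/Φ₀}(ℚ_∞) = p^{λ(E) + Σ_{v∈Σ₀} δ_v + 1}`
for a rational line `Φ₀` ramified at `p` and even, `μ(E) = 0`, granted A40 + A41, A133, A135, A137
and the lifting property. [cite: GreenbergVatsal2000, §2 pp. 14–15, 25, 28–30 (display (16))] -/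
theorem natCard_line_mul_quotSelmer_eq_of_split
    (hT : Silverman1994_thmV53_tateUniformisation.{0})
    (hT' : Silverman1994_thmV53_corV54_tateUniformisation.{0})
    (hA : lambda_nonPrimitive_eq_add_sum_delta_multiplicative)
    (hB : datumSelmer_divisible_of_finite_torsionBy)
    (hF : datumStrictSelmer_lt_datumSelmer_of_split)
    (hκ : κ.IsCyclotomic) (hγ : κ.IsTopGenerator γ) (hp2 : p ≠ 2)
    (hsplit : W.HasSplitMultiplicativeReductionAtPrime p)
    (hS₀ : ∀ v ∈ S₀, ((p : ℕ) : 𝓞 ℚ) ∉ v.asIdeal)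
    (hS : ∀ v : HeightOneSpectrum (𝓞 ℚ), v ∉ S₀ → ((p : ℕ) : 𝓞 ℚ) ∉ v.asIdeal →
      W.HasGoodReductionAt v)
    (D : W.SelmerDualData κ γ) [Module.Finite (IwasawaAlgebra p) D.X] (hX : D.IsTorsion)
    (hμ : D.mu = 0) (hram : ¬ LineUnramifiedAt W p Φ₀) (heven : LineEven W p Φ₀)
    (hlift : ∀ s ∈ ResidualDevissageSelmer.quotSelmer κ.kerSubgroup
        (ResidualDevissageLine.lineSub Φ₀ hΦ).Quot p (↑S₀ : Set (HeightOneSpectrum (𝓞 ℚ))),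
      ∃ x ∈ GreenbergVatsal2000.unramifiedOutside κ.kerSubgroup
          ↥((↥(W.geomPrimaryTorsion p))[(p : ℤ)]) p (↑S₀ : Set (HeightOneSpectrum (𝓞 ℚ))),
        ResidualDevissageSelmer.subH1 κ.kerSubgroup (ResidualDevissageLine.lineSub Φ₀ hΦ).proj
          (ResidualDevissageLine.lineSub Φ₀ hΦ).proj_smul x = s) :
    Nat.card (GreenbergVatsal2000.unramifiedOutside κ.kerSubgroup
        (ResidualDevissageLine.lineSub Φ₀ hΦ).Sub p (↑S₀ : Set (HeightOneSpectrum (𝓞 ℚ)))) *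
      Nat.card (ResidualDevissageSelmer.quotSelmer κ.kerSubgroup
        (ResidualDevissageLine.lineSub Φ₀ hΦ).Quot p (↑S₀ : Set (HeightOneSpectrum (𝓞 ℚ)))) =
    p ^ (lambdaInvariant p D.X + ∑ v ∈ S₀, delta W p v + 1) := by
  obtain ⟨L, htriv, -, hcard, -, hcount⟩ :=
    exists_data_count_of_split W p κ S₀ hT hA hB hF hκ hγ hp2 hsplit hS₀ hS D hX hμ
  have hS' : ∀ v : HeightOneSpectrum (𝓞 ℚ), v ∉ (↑S₀ : Set (HeightOneSpectrum (𝓞 ℚ))) →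
      ((p : ℕ) : 𝓞 ℚ) ∉ v.asIdeal → W.HasGoodReductionAt v :=
    fun v hv hpv ↦ hS v (fun h ↦ hv (Finset.mem_coe.2 h)) hpv
  obtain ⟨c, hc⟩ := exists_isComplexConjugation (Rat.castHom ℝ)
  have hdev := ResidualDevissageLine.natCard_gvSelmer_torsion_eq_mul_of_line hΦ hp2 hram heven L
    htriv hcard (↑S₀ : Set (HeightOneSpectrum (𝓞 ℚ))) hS' κ.kerSubgroup
    (ResidualDevissageLine.mem_kerSubgroup_of_isComplexConjugation κ hc) hc hlift
  have h28 := GreenbergVatsalTorsionCurve.natCard_gvSelmer_torsion_curve W p κ.kerSubgroup L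
    (↑S₀ : Set (HeightOneSpectrum (𝓞 ℚ))) hS' htriv
  rw [← hdev, h28, natCard_fixedPoints_quot_eq_one_of_line W p κ hΦ hT' hp2
    hsplit.hasMultiplicativeReductionAtPrime hκ hram heven, mul_one]
  change Nat.card ↥(gvSelmerInfty κ (W.geomPrimaryTorsion p) L ↑S₀ ⊓ _) = _
  rw [hcount]

end Summit.BirchSwinnertonDyer.Rank1Residual.X2.ResidualDevissageMultiplicative

end
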